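import Summits.NavierStokesRegularity.NavierStokesRegularity.Theorems.EfficiencyFloorRigidExitReferenceShadowingWindow
import Summits.NavierStokesRegularity.NavierStokesRegularity.Theorems.EfficiencyFloorRigidExitReferenceShadowingLimit
import Summits.NavierStokesRegularity.NavierStokesRegularity.Theorems.EfficiencyFloorRigidExitReferenceFlowWindow
import HarnessLib

/-!
# Route `EfficiencyFloor`, support `RigidExit` (stmt-NavierStokesRegularity-25513) on the `ProductionEfficiencyDecay` ladder
# (stmt-NavierStokesRegularity-22866): NORMALISED SHADOWING — the enstrophy of a slab solution near `m` at the early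
# instant is controlled by the reference enstrophy

Helper file (`--supports stmt-NavierStokesRegularity-22866`; line `efficiency_floor`). Census item (1) of hand g25 for the
residue (R-shadow) of `ReferenceShadowing.rigidExit_of_referenceShadowing` (p839834), ALL of whose inputs are in the tree:
the windowed shadowing estimate `shadow_window` (p840284), the `δ → 0⁺` glue `defect_eventually_lt` (p840304), continuity of
the reference enstrophy at interior times (`ReferenceFlow.enstrophy_continuousAt`, p839813), the window ceiling
(`ReferenceFlow.enstrophy_sq_mul_le`) and the vorticity triangle inequalities of `…ReferenceShadowingScale` (p839944).

* `ratio_bounds` — elementary bounds for a ratio pinched between `(1 ∓ ε)²`;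
* `normalised_shadowing` — for the reference package `(v,q)` through an admissible `m` with `Z(m) > 0` on `[0,T]`, a one-sided
  admissible constant `c > 0`, and `0 < η ≤ 1/4` with `2ηW_m < T` (`W_m = (64ν³/(27c⁴))·Z(m)⁻²`): for every `κ₀ > 0` there is
  `ε₀ > 0` such that EVERY classical solution `(w, q_w)` on a slab `[0, τ₂]` in the `L²`-Sobolev class with `Z(w 0) > 0`,
  `∫‖curl(w 0 − m)‖² ≤ ε₀²·Z(w 0)` and `ηW_{w 0} ≤ τ₂` satisfies
  `Z(w(η W_{w0})) ≤ Z(v(η W_m)) + κ₀ · Z(w 0)`.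

HONEST FRAMING: continuous dependence between two given smooth solutions; (R-shadow), `RigidExit`,
`NearMaximiserBoundedAmplification`, `LerayFloorGap`, `ProductionEfficiencyDecay` (stmt-22866) and Navier–Stokes regularity
stay OPEN; no summit statement is proved. [folklore]
-/

-- the problem directory repeats the summit name (`NavierStokesRegularity/NavierStokesRegularity`)
set_option linter.dupNamespace false

noncomputable section

open Set Filter MeasureTheory Topology Function InnerProductSpace
open scoped InnerProductSpace RealInnerProductSpace ENNReal NNReal ContDiff
open Literature.Analysis.FluidPDE

namespace Summit.NavierStokesRegularity.NavierStokesRegularity.Theorems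

namespace RigidExit

namespace ReferenceShadowing

section Normalised

variable {ν T : ℝ} {m : EuclideanSpace ℝ (Fin 3) → EuclideanSpace ℝ (Fin 3)}
  {v : ℝ → EuclideanSpace ℝ (Fin 3) → EuclideanSpace ℝ (Fin 3)} {q : ℝ → EuclideanSpace ℝ (Fin 3) → ℝ}

/-- Elementary: for `0 ≤ ε ≤ 1/10` and `(1-ε)² ≤ r ≤ (1+ε)²` one has `|r² − 1| ≤ 5ε`, `r² ≤ 3/2` and `1/2 ≤ r`. [folklore] -/
theorem ratio_bounds {ε r : ℝ} (hε : 0 ≤ ε) (hε1 : ε ≤ 1 / 10) (h1 : (1 - ε) ^ 2 ≤ r) (h2 : r ≤ (1 + ε) ^ 2) :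
    |r ^ 2 - 1| ≤ 5 * ε ∧ r ^ 2 ≤ 3 / 2 ∧ 1 / 2 ≤ r := by
  have hr0 : 0 ≤ r := le_trans (sq_nonneg _) h1
  have hup : r ^ 2 ≤ (1 + ε) ^ 4 := by
    have h := pow_le_pow_left₀ hr0 h2 2
    rwa [← pow_mul] at h
  have hlo : (1 - ε) ^ 4 ≤ r ^ 2 := by
    have h := pow_le_pow_left₀ (sq_nonneg _) h1 2
    rwa [← pow_mul] at h
  have e2 : ε ^ 2 ≤ ε / 10 := by nlinarith
  have e3 : ε ^ 3 ≤ ε / 100 := by nlinarith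
  have e4 : ε ^ 4 ≤ ε / 1000 := by nlinarith
  have x4 : (1 + ε) ^ 4 = 1 + 4 * ε + 6 * ε ^ 2 + 4 * ε ^ 3 + ε ^ 4 := by ring
  have y4 : (1 - ε) ^ 4 = 1 - 4 * ε + 6 * ε ^ 2 - 4 * ε ^ 3 + ε ^ 4 := by ring
  have y2 : (1 - ε) ^ 2 = 1 - 2 * ε + ε ^ 2 := by ring
  have p2 : 0 ≤ ε ^ 2 := sq_nonneg _
  have p4 : 0 ≤ ε ^ 4 := by positivity
  refine ⟨abs_le.2 ⟨?_, ?_⟩, ?_, ?_⟩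
  · linarith
  · linarith
  · linarith
  · linarith

/-- **Normalised shadowing.** Let `(v,q)` be the reference flow through an admissible `m` with `Z(m) = ∫‖curl m‖² > 0`
(Leray package on `[0,T]`), `c > 0` a one-sided admissible Lu–Doering constant, `0 < η ≤ 1/4` with `2·η·W_m < T`,
`W_m = (64ν³/(27c⁴))·Z(m)⁻²`. For every `κ₀ > 0` there is `ε₀ > 0` such that every classical forcing-free solution `(w, q_w)`
on a slab `[0, τ₂] × ℝ³` in the `L²`-Sobolev class with `Z(w 0) > 0`, `∫‖curl(w 0 − m)‖² ≤ ε₀²·Z(w 0)` and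
`η·W_{w 0} ≤ τ₂` (`W_{w0} = (64ν³/(27c⁴))·Z(w 0)⁻²`) satisfies `Z(w(η·W_{w 0})) ≤ Z(v(η·W_m)) + κ₀·Z(w 0)`.
[cite: RobinsonRodrigoSadowskiCUP2016, Thm 9.1] -/
theorem normalised_shadowing (hν : 0 < ν) (hT : 0 < T) (hLH : IsLerayHopfOn T ν 0 m v) (hv0 : v 0 = m)
    (hH1 : IsH1RegularOn (Icc 0 T) v) (hcl : IsClassicalNSSolutionOn (Ioc 0 T) ν 0 v q)
    (hB : ∀ δ : ℝ, 0 < δ → δ ≤ T → HasBoundedSobolevNormsOn (Icc δ T) v)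
    (hBt : ∀ δ : ℝ, 0 < δ → δ ≤ T → HasBoundedSobolevNormsOn (Icc δ T) (timeDerivWithin (Ioc 0 T) v))
    (hq : ∀ δ : ℝ, 0 < δ → δ ≤ T → ∀ n : ℕ, ∃ C : ℝ≥0, ∀ t ∈ Icc δ T, ∫⁻ x, ‖iteratedFDeriv ℝ n (q t) x‖ₑ ^ 2 ≤ C)
    (hm : ContDiff ℝ (⊤ : ℕ∞) m ∧ VectorCalculus.IsDivFree m ∧ (∫⁻ x, ‖iteratedFDeriv ℝ 0 m x‖ₑ ^ 2 < ⊤) ∧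
      (∫⁻ x, ‖iteratedFDeriv ℝ 1 m x‖ₑ ^ 2 < ⊤) ∧ (∫⁻ x, ‖iteratedFDeriv ℝ 2 m x‖ₑ ^ 2 < ⊤))
    {c : ℝ} (hc0 : 0 < c)
    (hc : ∀ w : EuclideanSpace ℝ (Fin 3) → EuclideanSpace ℝ (Fin 3), (ContDiff ℝ (⊤ : ℕ∞) w ∧
      VectorCalculus.IsDivFree w ∧ (∫⁻ x, ‖iteratedFDeriv ℝ 0 w x‖ₑ ^ 2 < ⊤) ∧
      (∫⁻ x, ‖iteratedFDeriv ℝ 1 w x‖ₑ ^ 2 < ⊤) ∧ (∫⁻ x, ‖iteratedFDeriv ℝ 2 w x‖ₑ ^ 2 < ⊤)) →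
      (∫ x, ⟪curl w x, fderiv ℝ w x (curl w x)⟫_ℝ) ≤ c * (∫ x, ‖curl w x‖ ^ 2) ^ (3 / 4 : ℝ) *
        (∫ x, frobeniusNormSq (fderiv ℝ (curl w) x)) ^ (3 / 4 : ℝ))
    (hZm : 0 < ∫ x, ‖curl m x‖ ^ 2) {η : ℝ} (hη : 0 < η) (hη4 : η ≤ 1 / 4)
    (hηT : 2 * (η * (64 * ν ^ 3 / (27 * c ^ 4) * (∫ x, ‖curl m x‖ ^ 2)⁻¹ ^ 2)) < T)
    {κ₀ : ℝ} (hκ₀ : 0 < κ₀) :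
    ∃ ε₀ : ℝ, 0 < ε₀ ∧ ∀ (w : ℝ → EuclideanSpace ℝ (Fin 3) → EuclideanSpace ℝ (Fin 3))
      (qw : ℝ → EuclideanSpace ℝ (Fin 3) → ℝ) (τ₂ : ℝ),
      IsClassicalNSSolutionOn (Icc 0 τ₂) ν 0 w qw → HasBoundedSobolevNormsOn (Icc 0 τ₂) w →
      HasBoundedSobolevNormsOn (Icc 0 τ₂) (timeDerivWithin (Icc 0 τ₂) w) →
      (∀ n : ℕ, ∃ C : ℝ≥0, ∀ t ∈ Icc 0 τ₂, ∫⁻ x, ‖iteratedFDeriv ℝ n (qw t) x‖ₑ ^ 2 ≤ C) →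
      0 < (∫ x, ‖curl (w 0) x‖ ^ 2) →
      (∫ x, ‖curl (w 0 - m) x‖ ^ 2) ≤ ε₀ ^ 2 * (∫ x, ‖curl (w 0) x‖ ^ 2) →
      η * (64 * ν ^ 3 / (27 * c ^ 4) * (∫ x, ‖curl (w 0) x‖ ^ 2)⁻¹ ^ 2) ≤ τ₂ →
      (∫ x, ‖curl (w (η * (64 * ν ^ 3 / (27 * c ^ 4) * (∫ x, ‖curl (w 0) x‖ ^ 2)⁻¹ ^ 2))) x‖ ^ 2) ≤
        (∫ x, ‖curl (v (η * (64 * ν ^ 3 / (27 * c ^ 4) * (∫ x, ‖curl m x‖ ^ 2)⁻¹ ^ 2))) x‖ ^ 2) +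
          κ₀ * (∫ x, ‖curl (w 0) x‖ ^ 2) := by
  obtain ⟨hmsm, hmdiv, hm0, hm1, hm2⟩ := hm
  have hA : 0 < 64 * ν ^ 3 / (27 * c ^ 4) := by positivity
  -- the reference instant `tstar = η W_m` and the window `τ₁ = 2 tstar`
  obtain ⟨tstar, htstar_def⟩ : ∃ t : ℝ, t = η * (64 * ν ^ 3 / (27 * c ^ 4) * (∫ x, ‖curl m x‖ ^ 2)⁻¹ ^ 2) :=
    ⟨_, rfl⟩
  rw [← htstar_def] at hηT ⊢
  have hKW : 2 * (27 * c ^ 4 / (128 * ν ^ 3)) * (∫ x, ‖curl m x‖ ^ 2) ^ 2 * (2 * tstar) = 2 * η := by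
    rw [htstar_def]
    field_simp
    ring
  have htstar : 0 < tstar := by rw [htstar_def]; positivity
  have hwin : 2 * (27 * c ^ 4 / (128 * ν ^ 3)) * (∫ x, ‖curl m x‖ ^ 2) ^ 2 * (2 * tstar) ≤ 1 / 2 := by
    rw [hKW]; linarith
  have hτ₁T : 2 * tstar < T := hηT
  -- (0) the shadowing constant on the window `[·, 2 tstar]`
  obtain ⟨B, hBB⟩ := shadow_window hν hT hLH hv0 hH1 hcl hB hBt hq ⟨hmsm, hmdiv, hm0, hm1, hm2⟩ hc hZm hτ₁T hwin
  obtain ⟨S, hS_def⟩ : ∃ S : ℝ, S = 2 * (27 * agmonConst ^ 4 / (2 * ν ^ 3) * Real.exp (2 * B)) := ⟨_, rfl⟩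
  rw [← hS_def] at hBB
  have hS0 : 0 ≤ S := by
    have := agmonConst_nonneg
    rw [hS_def]; positivity
  obtain ⟨E, hE_def⟩ : ∃ E : ℝ, E = Real.exp (max B 0) := ⟨_, rfl⟩
  have hE1 : 1 ≤ E := by rw [hE_def]; exact Real.one_le_exp (le_max_right _ _)
  have hEB : Real.exp B ≤ E := by rw [hE_def]; exact Real.exp_le_exp.2 (le_max_left _ _)
  have hE0 : 0 < E := by linarith
  -- (1) continuity of the reference enstrophy at `tstar`
  have htI : tstar ∈ Ioo 0 T := ⟨htstar, by linarith⟩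
  have hcont := ReferenceFlow.enstrophy_continuousAt hν hcl hB htI
  have hκZ : 0 < κ₀ * (∫ x, ‖curl m x‖ ^ 2) / 8 := by positivity
  obtain ⟨δ₁, hδ₁, hδ₁spec⟩ := Metric.continuousAt_iff.1 hcont _ hκZ
  -- (2) the choice of `ε₀`
  obtain ⟨M₁, hM₁_def⟩ : ∃ M : ℝ, M = 16 * S * (∫ x, ‖curl m x‖ ^ 2) ^ 2 * (2 * tstar) := ⟨_, rfl⟩
  have hM₁ : 0 ≤ M₁ := by rw [hM₁_def]; positivity
  obtain ⟨ε₀, hε₀_def⟩ : ∃ e : ℝ, e = min (1 / 10) (min (δ₁ / (10 * tstar)) (min (1 / (2 * M₁ + 2)) (κ₀ / (64 * E ^ 2)))) :=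
    ⟨_, rfl⟩
  have hε₀pos : 0 < ε₀ := by
    rw [hε₀_def]
    exact lt_min (by norm_num) (lt_min (by positivity) (lt_min (by positivity) (by positivity)))
  have hε₀1 : ε₀ ≤ 1 / 10 := by rw [hε₀_def]; exact min_le_left _ _
  have hε₀2 : ε₀ ≤ δ₁ / (10 * tstar) := by rw [hε₀_def]; exact (min_le_right _ _).trans (min_le_left _ _)
  have hε₀3 : ε₀ ≤ 1 / (2 * M₁ + 2) := by
    rw [hε₀_def]; exact ((min_le_right _ _).trans (min_le_right _ _)).trans (min_le_left _ _)
  have hε₀4 : ε₀ ≤ κ₀ / (64 * E ^ 2) := by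
    rw [hε₀_def]; exact ((min_le_right _ _).trans (min_le_right _ _)).trans (min_le_right _ _)
  have hε₀le1 : ε₀ ≤ 1 := hε₀1.trans (by norm_num)
  refine ⟨ε₀, hε₀pos, fun w qw τ₂ hw hW hWt hqw hZw0 hclose hτ₂ => ?_⟩
  -- the evaluation time `τ = η W_{w0}`
  obtain ⟨τ, hτ_def⟩ : ∃ t : ℝ, t = η * (64 * ν ^ 3 / (27 * c ^ 4) * (∫ x, ‖curl (w 0) x‖ ^ 2)⁻¹ ^ 2) := ⟨_, rfl⟩
  rw [← hτ_def] at hτ₂ ⊢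
  have hτpos : 0 < τ := by rw [hτ_def]; positivity
  have hτ₂pos : 0 < τ₂ := hτpos.trans_le hτ₂
  -- smoothness / Sobolev finiteness along `w` and `v`
  have hwfin : ∀ t ∈ Icc 0 τ₂, ∀ n : ℕ, ∫⁻ x, ‖iteratedFDeriv ℝ n (w t) x‖ₑ ^ 2 < ⊤ := fun t ht n => by
    obtain ⟨C, hC⟩ := hW n
    exact (hC t ht).trans_lt ENNReal.coe_lt_top
  have hvfin : ∀ t ∈ Ioc 0 T, ∀ n : ℕ, ∫⁻ x, ‖iteratedFDeriv ℝ n (v t) x‖ₑ ^ 2 < ⊤ := fun t ht n => by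
    obtain ⟨C, hC⟩ := hB t ht.1 ht.2 n
    exact (hC t ⟨le_rfl, ht.2⟩).trans_lt ENNReal.coe_lt_top
  have hwsm : ∀ t ∈ Icc 0 τ₂, ContDiff ℝ (⊤ : ℕ∞) (w t) := fun t ht => hw.contDiff_velocity ht
  have hvsm : ∀ t ∈ Ioc 0 T, ContDiff ℝ (⊤ : ℕ∞) (v t) := fun t ht => hcl.contDiff_velocity ht
  have h0τ₂ : (0 : ℝ) ∈ Icc 0 τ₂ := ⟨le_rfl, hτ₂pos.le⟩
  -- (3) the enstrophy window at time `0`: `(1-ε₀)² Zw0 ≤ Zm ≤ (1+ε₀)² Zw0`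
  obtain ⟨hwin1, hwin2⟩ := enstrophy_window_of_close (hwsm 0 h0τ₂) (hwfin 0 h0τ₂ 1) hmsm hm1 hε₀pos.le hε₀le1 hclose
  -- the ratio `r = Zm / Zw0` and `τ = tstar · r²`
  obtain ⟨r, hr_def⟩ : ∃ r : ℝ, r = (∫ x, ‖curl m x‖ ^ 2) / (∫ x, ‖curl (w 0) x‖ ^ 2) := ⟨_, rfl⟩
  have hr1 : (1 - ε₀) ^ 2 ≤ r := by rw [hr_def, le_div_iff₀ hZw0]; exact hwin1
  have hr2 : r ≤ (1 + ε₀) ^ 2 := by rw [hr_def, div_le_iff₀ hZw0]; exact hwin2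
  obtain ⟨hrabs, hrsq, hrhalf⟩ := ratio_bounds hε₀pos.le hε₀1 hr1 hr2
  have hτeq : τ = tstar * r ^ 2 := by
    rw [hτ_def, htstar_def, hr_def]
    field_simp
  have hττ₁ : τ ≤ 2 * tstar := by
    rw [hτeq]
    nlinarith only [hrsq, htstar]
  have hτT : τ < T := hττ₁.trans_lt hτ₁T
  have hτclose : dist τ tstar < δ₁ := by
    rw [Real.dist_eq, hτeq, show tstar * r ^ 2 - tstar = tstar * (r ^ 2 - 1) by ring, abs_mul, abs_of_pos htstar]
    have h5 : tstar * |r ^ 2 - 1| ≤ tstar * (5 * ε₀) := mul_le_mul_of_nonneg_left hrabs htstar.le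
    have h6 : tstar * (5 * ε₀) ≤ tstar * (5 * (δ₁ / (10 * tstar))) := by gcongr
    have h7 : tstar * (5 * (δ₁ / (10 * tstar))) = δ₁ / 2 := by field_simp; ring
    linarith only [h5, h6, h7, hδ₁]
  have hZvclose : |(∫ x, ‖curl (v τ) x‖ ^ 2) - ∫ x, ‖curl (v tstar) x‖ ^ 2| < κ₀ * (∫ x, ‖curl m x‖ ^ 2) / 8 := by
    have := hδ₁spec hτclose
    rwa [Real.dist_eq] at this
  -- (4) the window ceiling at `τ`: `Zv τ ≤ 2 Zm`
  have hceil := ReferenceFlow.enstrophy_sq_mul_le hν hT hLH hv0 hH1 hcl hB ⟨hmsm, hmdiv, hm0, hm1, hm2⟩ hc hZm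
    (t := τ) ⟨hτpos.le, hτT⟩
  have hZvτ0 : 0 ≤ ∫ x, ‖curl (v τ) x‖ ^ 2 := integral_nonneg fun x => by positivity
  have hK0 : 0 ≤ 2 * (27 * c ^ 4 / (128 * ν ^ 3)) * (∫ x, ‖curl m x‖ ^ 2) ^ 2 := by positivity
  have hKτ : 2 * (27 * c ^ 4 / (128 * ν ^ 3)) * (∫ x, ‖curl m x‖ ^ 2) ^ 2 * τ ≤ 1 / 2 :=
    (mul_le_mul_of_nonneg_left hττ₁ hK0).trans hwin
  have hZvτ : (∫ x, ‖curl (v τ) x‖ ^ 2) ≤ 2 * ∫ x, ‖curl m x‖ ^ 2 := by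
    have h1 : (∫ x, ‖curl (v τ) x‖ ^ 2) ^ 2 * (1 / 2) ≤ (∫ x, ‖curl m x‖ ^ 2) ^ 2 := by
      refine le_trans ?_ hceil
      exact mul_le_mul_of_nonneg_left (by linarith only [hKτ]) (sq_nonneg _)
    nlinarith only [h1, hZm, hZvτ0]
  -- (5) the defect at small positive times and the shadowing estimate at `τ`
  obtain ⟨D', hD'_def⟩ : ∃ D : ℝ, D = 2 * ε₀ ^ 2 * (∫ x, ‖curl (w 0) x‖ ^ 2) := ⟨_, rfl⟩
  have hε₀Z : 0 < ε₀ ^ 2 * (∫ x, ‖curl (w 0) x‖ ^ 2) := by positivity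
  have hD'pos : 0 < D' := by rw [hD'_def]; positivity
  have hD'lt : (∫ x, ‖curl (w 0 - m) x‖ ^ 2) < D' := by rw [hD'_def]; linarith
  have hev := defect_eventually_lt hT hLH hv0 hH1 hcl hB ⟨hmsm, hmdiv, hm0, hm1, hm2⟩ hτ₂pos hw hW hWt hD'lt
  obtain ⟨δ, hXδ, hδI⟩ := (hev.and (Ioo_mem_nhdsGT hτpos)).exists
  -- `D' ≤ 4 ε₀² Zm` and the smallness `S · D'² · τ₁ ≤ 1/2`
  have hZw0le : (∫ x, ‖curl (w 0) x‖ ^ 2) ≤ 2 * ∫ x, ‖curl m x‖ ^ 2 := by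
    have e1 := mul_le_mul_of_nonneg_left hε₀1 hZw0.le
    have e2 := mul_nonneg (sq_nonneg ε₀) hZw0.le
    have e3 : (1 - ε₀) ^ 2 * (∫ x, ‖curl (w 0) x‖ ^ 2) =
        (∫ x, ‖curl (w 0) x‖ ^ 2) - 2 * ((∫ x, ‖curl (w 0) x‖ ^ 2) * ε₀) + ε₀ ^ 2 * (∫ x, ‖curl (w 0) x‖ ^ 2) := by
      ring
    linarith only [hwin1, e1, e2, e3, hZw0]
  have hZm2 : (∫ x, ‖curl m x‖ ^ 2) ≤ 2 * ∫ x, ‖curl (w 0) x‖ ^ 2 := by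
    have hsq : (1 + ε₀) ^ 2 ≤ 2 := by nlinarith only [hε₀1, hε₀pos]
    have := mul_le_mul_of_nonneg_right hsq hZw0.le
    linarith only [hwin2, this]
  have hD'le : D' ≤ 4 * ε₀ ^ 2 * ∫ x, ‖curl m x‖ ^ 2 := by
    have := mul_le_mul_of_nonneg_left hZw0le (sq_nonneg ε₀)
    rw [hD'_def]; linarith only [this]
  have hε₀sq : ε₀ ^ 4 ≤ ε₀ := by
    have h1 : ε₀ ^ 4 ≤ ε₀ ^ 1 := pow_le_pow_of_le_one hε₀pos.le hε₀le1 (by norm_num)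
    rwa [pow_one] at h1
  have hsmall_le : S * D' ^ 2 * (2 * tstar) ≤ 1 / 2 := by
    have h1 : S * D' ^ 2 * (2 * tstar) ≤ S * (4 * ε₀ ^ 2 * ∫ x, ‖curl m x‖ ^ 2) ^ 2 * (2 * tstar) := by
      have : D' ^ 2 ≤ (4 * ε₀ ^ 2 * ∫ x, ‖curl m x‖ ^ 2) ^ 2 := pow_le_pow_left₀ hD'pos.le hD'le 2
      have hSτ : 0 ≤ S * (2 * tstar) := by positivity
      have h := mul_le_mul_of_nonneg_left this hSτ
      linarith only [h]
    have h2 : S * (4 * ε₀ ^ 2 * ∫ x, ‖curl m x‖ ^ 2) ^ 2 * (2 * tstar) = M₁ * ε₀ ^ 4 := by rw [hM₁_def]; ring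
    have h3 : M₁ * ε₀ ^ 4 ≤ M₁ * ε₀ := mul_le_mul_of_nonneg_left hε₀sq hM₁
    have h4 : M₁ * ε₀ ≤ M₁ * (1 / (2 * M₁ + 2)) := mul_le_mul_of_nonneg_left hε₀3 hM₁
    have h5 : M₁ * (1 / (2 * M₁ + 2)) ≤ 1 / 2 := by
      rw [mul_one_div, div_le_iff₀ (by positivity)]
      linarith only [hM₁]
    linarith only [h1, h2, h3, h4, h5]
  have hsmall : S * D' ^ 2 * (2 * tstar) < 1 := by linarith only [hsmall_le]
  have hX := hBB w qw τ₂ hw hW hWt hqw δ τ D' hδI.1 hδI.2 hττ₁ hτ₂ hXδ.le hsmall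
  -- `X(τ) ≤ 2 e^B D' ≤ 8 E² ε₀² Zm`
  have hXle : (∫ x, frobeniusNormSq (fderiv ℝ ((w - v) τ) x)) ≤ 8 * E ^ 2 * ε₀ ^ 2 * ∫ x, ‖curl m x‖ ^ 2 := by
    have hroot : 1 / 2 ≤ Real.sqrt (1 - S * D' ^ 2 * (2 * tstar)) := by
      calc (1 / 2 : ℝ) = Real.sqrt ((1 / 2) ^ 2) := (Real.sqrt_sq (by norm_num)).symm
        _ ≤ Real.sqrt (1 - S * D' ^ 2 * (2 * tstar)) := Real.sqrt_le_sqrt (by linarith only [hsmall_le])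
    have hnum : 0 ≤ Real.exp B * D' := by positivity
    have h1 : Real.exp B * D' / Real.sqrt (1 - S * D' ^ 2 * (2 * tstar)) ≤ Real.exp B * D' / (1 / 2) :=
      div_le_div_of_nonneg_left hnum (by norm_num) hroot
    have h2 : Real.exp B * D' / (1 / 2) = 2 * (Real.exp B * D') := by ring
    have h3 : Real.exp B * D' ≤ E * (4 * ε₀ ^ 2 * ∫ x, ‖curl m x‖ ^ 2) := mul_le_mul hEB hD'le hD'pos.le hE0.le
    have h4 : E * (4 * ε₀ ^ 2 * ∫ x, ‖curl m x‖ ^ 2) ≤ E ^ 2 * (4 * ε₀ ^ 2 * ∫ x, ‖curl m x‖ ^ 2) := by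
      have : E ≤ E ^ 2 := by nlinarith only [hE1]
      exact mul_le_mul_of_nonneg_right this (by positivity)
    calc (∫ x, frobeniusNormSq (fderiv ℝ ((w - v) τ) x))
        ≤ Real.exp B * D' / Real.sqrt (1 - S * D' ^ 2 * (2 * tstar)) := hX
      _ ≤ 2 * (Real.exp B * D') := by rw [← h2]; exact h1
      _ ≤ 8 * E ^ 2 * ε₀ ^ 2 * ∫ x, ‖curl m x‖ ^ 2 := by linarith only [h3, h4]
  -- (6) `X(τ) = Z(w τ − v τ)` (div–curl) and the vorticity triangle inequality at `τ`
  have hτw : τ ∈ Icc 0 τ₂ := ⟨hτpos.le, hτ₂⟩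
  have hτv : τ ∈ Ioc 0 T := ⟨hτpos, hτT.le⟩
  have sw : ContDiff ℝ (⊤ : ℕ∞) (w τ) := hwsm τ hτw
  have sv : ContDiff ℝ (⊤ : ℕ∞) (v τ) := hvsm τ hτv
  have sF : ContDiff ℝ (⊤ : ℕ∞) (w τ - v τ) := sw.sub sv
  have f_wv : ∀ n : ℕ, ∫⁻ x, ‖iteratedFDeriv ℝ n (w τ - v τ) x‖ₑ ^ 2 < ⊤ := fun n =>
    lintegral_iteratedFDeriv_sub_lt_top sw sv n (hwfin τ hτw n) (hvfin τ hτv n)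
  have hdivF : VectorCalculus.IsDivFree (w τ - v τ) := fun x => by
    rw [show (w τ - v τ) = fun y => w τ y - v τ y from rfl,
      divergence_sub_apply (sw.differentiable (by norm_cast) x) (sv.differentiable (by norm_cast) x),
      hw.divFree τ hτw x, hcl.divFree τ hτv x, sub_zero]
  have h0F : ∫⁻ x, ‖(w τ - v τ) x‖ₑ ^ 2 < ⊤ := by
    refine lt_of_le_of_lt (le_of_eq (lintegral_congr fun x => ?_)) (f_wv 0)
    rw [← ofReal_norm, ← ofReal_norm, norm_iteratedFDeriv_zero]
  have hXZ : (∫ x, frobeniusNormSq (fderiv ℝ ((w - v) τ) x)) = ∫ x, ‖curl (w τ - v τ) x‖ ^ 2 := by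
    rw [show (w - v) τ = w τ - v τ from rfl]
    exact integral_frobeniusNormSq_fderiv_eq_integral_norm_curl_sq (sF.of_le (by norm_cast)) hdivF h0F (f_wv 1) (f_wv 2)
  have htri := sqrt_enstrophy_sub_le sw (hwfin τ hτw 1) sv (hvfin τ hτv 1)
  -- square roots: `√Z(wτ) ≤ √Zv τ + √Zd`, `Zd ≤ 8E²ε₀²Zm`
  have hZwτ0 : 0 ≤ ∫ x, ‖curl (w τ) x‖ ^ 2 := integral_nonneg fun x => by positivity
  have hZd0 : 0 ≤ ∫ x, ‖curl (w τ - v τ) x‖ ^ 2 := integral_nonneg fun x => by positivity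
  have hZdle : (∫ x, ‖curl (w τ - v τ) x‖ ^ 2) ≤ 8 * E ^ 2 * ε₀ ^ 2 * ∫ x, ‖curl m x‖ ^ 2 := by
    rw [← hXZ]; exact hXle
  have hsq1 : Real.sqrt (∫ x, ‖curl (w τ) x‖ ^ 2) ≤
      Real.sqrt (∫ x, ‖curl (v τ) x‖ ^ 2) + Real.sqrt (∫ x, ‖curl (w τ - v τ) x‖ ^ 2) := by
    have := (abs_sub_le_iff.1 htri).1
    linarith only [this]
  have hprod : Real.sqrt (∫ x, ‖curl (v τ) x‖ ^ 2) * Real.sqrt (∫ x, ‖curl (w τ - v τ) x‖ ^ 2) ≤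
      4 * E * ε₀ * ∫ x, ‖curl m x‖ ^ 2 := by
    rw [← Real.sqrt_mul hZvτ0]
    have h1 : (∫ x, ‖curl (v τ) x‖ ^ 2) * (∫ x, ‖curl (w τ - v τ) x‖ ^ 2) ≤ (4 * E * ε₀ * ∫ x, ‖curl m x‖ ^ 2) ^ 2 := by
      calc (∫ x, ‖curl (v τ) x‖ ^ 2) * (∫ x, ‖curl (w τ - v τ) x‖ ^ 2)
          ≤ (2 * ∫ x, ‖curl m x‖ ^ 2) * (8 * E ^ 2 * ε₀ ^ 2 * ∫ x, ‖curl m x‖ ^ 2) :=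
            mul_le_mul hZvτ hZdle hZd0 (by positivity)
        _ = (4 * E * ε₀ * ∫ x, ‖curl m x‖ ^ 2) ^ 2 := by ring
    calc Real.sqrt ((∫ x, ‖curl (v τ) x‖ ^ 2) * (∫ x, ‖curl (w τ - v τ) x‖ ^ 2))
        ≤ Real.sqrt ((4 * E * ε₀ * ∫ x, ‖curl m x‖ ^ 2) ^ 2) := Real.sqrt_le_sqrt h1
      _ = 4 * E * ε₀ * ∫ x, ‖curl m x‖ ^ 2 := Real.sqrt_sq (by positivity)
  have hZwτle : (∫ x, ‖curl (w τ) x‖ ^ 2) ≤ (∫ x, ‖curl (v τ) x‖ ^ 2) + 16 * E ^ 2 * ε₀ * ∫ x, ‖curl m x‖ ^ 2 := by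
    have h1 : (∫ x, ‖curl (w τ) x‖ ^ 2) ≤
        (Real.sqrt (∫ x, ‖curl (v τ) x‖ ^ 2) + Real.sqrt (∫ x, ‖curl (w τ - v τ) x‖ ^ 2)) ^ 2 := by
      calc (∫ x, ‖curl (w τ) x‖ ^ 2) = (Real.sqrt (∫ x, ‖curl (w τ) x‖ ^ 2)) ^ 2 := (Real.sq_sqrt hZwτ0).symm
        _ ≤ (Real.sqrt (∫ x, ‖curl (v τ) x‖ ^ 2) + Real.sqrt (∫ x, ‖curl (w τ - v τ) x‖ ^ 2)) ^ 2 :=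
          pow_le_pow_left₀ (Real.sqrt_nonneg _) hsq1 2
    have h2 : (Real.sqrt (∫ x, ‖curl (v τ) x‖ ^ 2) + Real.sqrt (∫ x, ‖curl (w τ - v τ) x‖ ^ 2)) ^ 2 =
        (∫ x, ‖curl (v τ) x‖ ^ 2) +
          2 * (Real.sqrt (∫ x, ‖curl (v τ) x‖ ^ 2) * Real.sqrt (∫ x, ‖curl (w τ - v τ) x‖ ^ 2)) +
          ∫ x, ‖curl (w τ - v τ) x‖ ^ 2 := by
      rw [add_sq, Real.sq_sqrt hZvτ0, Real.sq_sqrt hZd0]; ring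
    have hε₀sq' : ε₀ ^ 2 ≤ ε₀ := by nlinarith only [hε₀pos, hε₀le1]
    have hE2 : 0 ≤ 8 * E ^ 2 * ∫ x, ‖curl m x‖ ^ 2 := by positivity
    have h3 : (∫ x, ‖curl (w τ - v τ) x‖ ^ 2) ≤ 8 * E ^ 2 * ε₀ * ∫ x, ‖curl m x‖ ^ 2 := by
      refine hZdle.trans ?_
      have := mul_le_mul_of_nonneg_left hε₀sq' hE2
      linarith only [this]
    have h4 : 4 * E * ε₀ * (∫ x, ‖curl m x‖ ^ 2) ≤ 4 * E ^ 2 * ε₀ * ∫ x, ‖curl m x‖ ^ 2 := by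
      have hEE : E ≤ E ^ 2 := by nlinarith only [hE1]
      have h0 : 0 ≤ 4 * ε₀ * ∫ x, ‖curl m x‖ ^ 2 := by positivity
      have := mul_le_mul_of_nonneg_right hEE h0
      linarith only [this]
    linarith only [h1, h2, hprod, h3, h4]
  -- (7) conclusion
  have hextra : 16 * E ^ 2 * ε₀ * (∫ x, ‖curl m x‖ ^ 2) ≤ κ₀ * (∫ x, ‖curl m x‖ ^ 2) / 4 := by
    have h1 : 16 * E ^ 2 * ε₀ ≤ 16 * E ^ 2 * (κ₀ / (64 * E ^ 2)) := mul_le_mul_of_nonneg_left hε₀4 (by positivity)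
    have h2 : 16 * E ^ 2 * (κ₀ / (64 * E ^ 2)) = κ₀ / 4 := by field_simp; ring
    have h3 : 16 * E ^ 2 * ε₀ * (∫ x, ‖curl m x‖ ^ 2) ≤ κ₀ / 4 * ∫ x, ‖curl m x‖ ^ 2 :=
      mul_le_mul_of_nonneg_right (h2 ▸ h1) hZm.le
    linarith only [h3]
  have hZvτle : (∫ x, ‖curl (v τ) x‖ ^ 2) ≤ (∫ x, ‖curl (v tstar) x‖ ^ 2) + κ₀ * (∫ x, ‖curl m x‖ ^ 2) / 8 := by
    have := (abs_lt.1 hZvclose).2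
    linarith only [this]
  have hk : κ₀ * (∫ x, ‖curl m x‖ ^ 2) / 8 + κ₀ * (∫ x, ‖curl m x‖ ^ 2) / 4 ≤ κ₀ * ∫ x, ‖curl (w 0) x‖ ^ 2 := by
    have h1 := mul_le_mul_of_nonneg_left hZm2 hκ₀.le
    have h2 := mul_pos hκ₀ hZw0
    linarith only [h1, h2]
  linarith only [hZwτle, hextra, hZvτle, hk]

end Normalised

end ReferenceShadowing

end RigidExit

end Summit.NavierStokesRegularity.NavierStokesRegularity.Theorems

end
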